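import Literature.Combinatorics.StablePolynomials.BoundedDegreeStabilityPreservers
import Literature.Combinatorics.StablePolynomials.RealStabilityPreserversNecessity
import HarnessLib

/-!
# Borcea–Brändén I, Theorem 1.2 (real stability preservers) for every number of variables and every
# degree bound `κ ≥ 1`

J. Borcea, P. Brändén, *The Lee–Yang and Pólya–Schur programs. I. Linear operators preserving stability*,
Invent. Math. 177 (2009) 541–569 (arXiv:0809.0401), §1.1:

> **Theorem 1.2.** Let `κ ∈ ℕⁿ` and `T : ℝ_κ[z_1,…,z_n] → ℝ[z_1,…,z_n]` be a linear operator. Then `T`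
> preserves real stability if and only if either
> (a) `T` has range of dimension no greater than two and is of the form `T(f) = α(f)P + β(f)Q`, where
> `α, β : ℝ_κ[z_1,…,z_n] → ℝ` are linear functionals and `P, Q` are real stable polynomials such that
> `P ≪ Q`, or
> (b) `G_T(z,w) ∈ 𝓗_{2n}(ℝ)`, or
> (c) `G_T(z,-w) ∈ 𝓗_{2n}(ℝ)`.

This file proves the theorem for every finite set of variables `τ` and **every `κ` with `κ_i ≥ 1`**
(`BorceaBranden_realStabilityPreserver_iff`), by the reduction of §2.2 along a fiber map `b : σ → τ`
(`κ_i = |b⁻¹(i)|`, `Π↓ = rename b`, a section `s` of `b`, `ι = rename s`) to the multi-affine Theorem 1.2 of the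
tree (`multiAffine_realStabilityPreserver_iff`, `forall_apply_or_symbol`, `RealStabilityPreservers(Necessity).lean`),
exactly as `BoundedDegreeStabilityPreservers.lean` does for Theorem 1.1 and
`UnivariateRealStabilityPreservers.lean` for `n = 1`:
* the real polarization `realFiberPolarization` complexifies to `fiberPolarization` (`Π↑`), so the preserver
  property transfers between `T` on `ℝ_κ[z_τ]` and `L = ι ∘ T ∘ Π↓` on multi-affine polynomials
  (`realFiberLift_preserves`, `preserves_of_realFiberLift`; Prop. 2.4);
* `(L)_ℂ = ι ∘ T_ℂ ∘ Π↓` (`complexify_realFiberLift`), so by `G_{L_ℂ} = G_L` and the symbol comparison of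
  Theorem 1.1 (`isUpperHalfPlaneStable_multiAffineSymbol_fiberLift_iff`) case (b) for `L` is case (b) for `T`;
* `G_L(z,-w) = G_{L'}(z,w)` with `L' = (T')~`, `T'(f) = (-1)^{|κ|} T(f(-z))` (tree `realMultiAffineSymbol_negTwist`,
  here `negTwist_realFiberLift`), and `G_{T'}(z,w) = G_T(z,-w)`, so case (c) for `L` is case (c) for `T`;
* if all `L(h)` are real stable or zero then so are all `T(p)`, `p ∈ ℝ_κ[z_τ]`, and Lemma 3.2 (i) with
  Theorem 1.9 inside `T(ℝ_κ[z_τ]) ⊆ ℝ[z_τ]` give (a) (`exists_rankTwo_of_forall_mem`).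

## Contents

* §1 `realFiberLift`, `realFiberPolarization` (+ `map_realFiberPolarization`, `rename_realFiberPolarization`,
  `isRealStable_realFiberPolarization_iff`), `realFiberLift_preserves`, `preserves_of_realFiberLift`.
* §2 `complexify_realFiberLift`, `isRealStable_realMultiAffineSymbol_realFiberLift_iff`, `signedFlip`,
  `negTwist_realFiberLift`, `isRealStable_negInr_realMultiAffineSymbol_realFiberLift_iff`.
* §3 `degreeLESubmodule`, `exists_rankTwo_of_forall_mem` (rank-two alternative on a submodule),
  **`boundedDegree_realStabilityPreserver_iff_fiber`**.
* §4 `realBoundedDegreeSymbol` (`G_T(z,w)`), `realBoundedDegreeSymbolNeg` (`G_T(z,-w)`), their complexified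
  evaluations, **`BorceaBranden_realStabilityPreserver_iff`** (Theorem 1.2, all `n`, all `κ ≥ 1`).

## References

* [BorceaBranden2009] J. Borcea, P. Brändén, Invent. Math. 177 (2009) 541–569, §1.1 Thm. 1.2, §1.2 (`≪`,
  Thm. 1.9), §2.2 (Π↑_κ, Π↓_κ, Prop. 2.4), §3 Lemma 3.2, §4 (proof of Thm. 1.2).
-/

noncomputable section

open MvPolynomial Finset

namespace Literature.Combinatorics.StablePolynomials

variable {σ τ : Type*} (b : σ → τ) (s : τ → σ)

/-! ## §1 The real lift and the real polarization -/

section RealLift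

/-- **The real multi-affine lift `L = ι ∘ T ∘ Π↓`.** [cite: BorceaBranden2009, §2.2 ("(c) … reduce to the case of
multi-affine polynomials")] -/
def realFiberLift (T : MvPolynomial τ ℝ →ₗ[ℝ] MvPolynomial τ ℝ) : MvPolynomial σ ℝ →ₗ[ℝ] MvPolynomial σ ℝ :=
  (rename s : MvPolynomial τ ℝ →ₐ[ℝ] MvPolynomial σ ℝ).toLinearMap ∘ₗ T ∘ₗ
    (rename b : MvPolynomial σ ℝ →ₐ[ℝ] MvPolynomial τ ℝ).toLinearMap

/-- `L f = ι(T(Π↓ f))`. [cite: BorceaBranden2009, §2.2] -/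
theorem realFiberLift_apply (T : MvPolynomial τ ℝ →ₗ[ℝ] MvPolynomial τ ℝ) (f : MvPolynomial σ ℝ) :
    realFiberLift b s T f = rename s (T (rename b f)) :=
  rfl

/-- **`ι = rename s` preserves and reflects real stability** (`b ∘ s = id`). [cite: BorceaBranden2009, §1] -/
theorem isRealStable_rename_section_iff (hs : ∀ i, b (s i) = i) (p : MvPolynomial τ ℝ) :
    IsRealStable (rename s p) ↔ IsRealStable p := by
  rw [IsRealStable, IsRealStable, map_rename, isUpperHalfPlaneStable_rename_section_iff b s hs]

omit s in
/-- **`Π↓` preserves real stability.** [cite: BorceaBranden2009, §2.2 ("(a)")] -/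
theorem IsRealStable.rename_fiberMap {F : MvPolynomial σ ℝ} (hF : IsRealStable F) : IsRealStable (rename b F) := by
  rw [IsRealStable, map_rename]
  exact isUpperHalfPlaneStable_rename_fiberMap b hF

/-- `rename s` is injective for a section `s`. [folklore] -/
private theorem rename_section_injective_real (hs : ∀ i, b (s i) = i) :
    Function.Injective (rename s : MvPolynomial τ ℝ → MvPolynomial σ ℝ) :=
  rename_injective s fun i j h => by rw [← hs i, ← hs j, h]

omit b s in
/-- Complexification does not change partial degrees. [folklore] -/
private theorem degreeOf_map_algebraMap (p : MvPolynomial τ ℝ) (i : τ) :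
    degreeOf i (map (algebraMap ℝ ℂ) p) = degreeOf i p := by
  rw [degreeOf_eq_sup, degreeOf_eq_sup, support_map_of_injective _ (algebraMap ℝ ℂ).injective]

variable [Fintype σ] [DecidableEq τ]

omit s in
/-- **`deg_{z_i} Π↓f ≤ κ_i`** for real multi-affine `f`. [cite: BorceaBranden2009, §2.2] -/
theorem degreeOf_rename_le_card_fiber_real {f : MvPolynomial σ ℝ} (hf : IsMultiAffine f) (i : τ) :
    degreeOf i (rename b f) ≤ (fiber b i).card := by
  rw [← degreeOf_map_algebraMap, map_rename]
  exact degreeOf_rename_le_card_fiber b (isMultiAffine_map_algebraMap hf) i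

omit s in
/-- `e_k` of a block has integer coefficients: it complexifies to itself. [cite: BorceaBranden2009, §2.2] -/
theorem map_fiberEsymm (i : τ) (k : ℕ) :
    map (algebraMap ℝ ℂ) (fiberEsymm b i k : MvPolynomial σ ℝ) = fiberEsymm b i k := by
  rw [fiberEsymm, fiberEsymm, map_sum]
  refine sum_congr rfl fun S _ => ?_
  rw [map_prod]
  simp only [map_X]

variable [Fintype τ]

omit s in
/-- **The real polarization `Π↑` along `b`**, on the monomial basis: `Π↑(z^α) = Π_i binom(κ_i,α_i)⁻¹ e_{α_i}(block i)`.
[cite: BorceaBranden2009, §2.2 (formula for `Π↑_κ(z^α)`, `𝕂 = ℝ`)] -/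
def realFiberPolarization : MvPolynomial τ ℝ →ₗ[ℝ] MvPolynomial σ ℝ :=
  (basisMonomials τ ℝ).constr ℝ fun α =>
    ∏ i, ((((fiber b i).card.choose (α i) : ℕ) : ℝ)⁻¹ • (fiberEsymm b i (α i) : MvPolynomial σ ℝ))

omit s in
/-- `Π↑` on real monomials. [cite: BorceaBranden2009, §2.2] -/
theorem realFiberPolarization_monomial (α : τ →₀ ℕ) (c : ℝ) :
    realFiberPolarization b (monomial α c) =
      c • ∏ i, ((((fiber b i).card.choose (α i) : ℕ) : ℝ)⁻¹ • (fiberEsymm b i (α i) : MvPolynomial σ ℝ)) := by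
  have h : (monomial α c : MvPolynomial τ ℝ) = c • basisMonomials τ ℝ α := by
    rw [coe_basisMonomials, smul_monomial, smul_eq_mul, mul_one]
  rw [h, map_smul, realFiberPolarization, Module.Basis.constr_basis]

omit s in
/-- **The real `Π↑` complexifies to `Π↑`.** [cite: BorceaBranden2009, §2.2 (Π↑_κ for `𝕂 = ℝ, ℂ`)] -/
theorem map_realFiberPolarization (p : MvPolynomial τ ℝ) :
    map (algebraMap ℝ ℂ) (realFiberPolarization b p) = fiberPolarization b (map (algebraMap ℝ ℂ) p) := by
  induction p using MvPolynomial.induction_on' with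
  | monomial α a =>
    rw [map_monomial, realFiberPolarization_monomial, fiberPolarization_monomial, smul_eq_C_mul, smul_eq_C_mul,
      _root_.map_mul (MvPolynomial.map (algebraMap ℝ ℂ)), map_C,
      _root_.map_prod (MvPolynomial.map (algebraMap ℝ ℂ))]
    congr 1
    refine prod_congr rfl fun i _ => ?_
    rw [smul_eq_C_mul, smul_eq_C_mul, _root_.map_mul (MvPolynomial.map (algebraMap ℝ ℂ)), map_C,
      map_fiberEsymm, map_inv₀, map_natCast]
  | add p q hp hq => rw [map_add, map_add, hp, hq, map_add, map_add]

omit s in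
/-- **`Π↓Π↑ = id` on `ℝ_κ[z_τ]`.** [cite: BorceaBranden2009, §2.2 ("(b) `Π↓_κ ∘ Π↑_κ = id`")] -/
theorem rename_realFiberPolarization {p : MvPolynomial τ ℝ} (hp : ∀ i, degreeOf i p ≤ (fiber b i).card) :
    rename b (realFiberPolarization b p) = p := by
  apply map_injective (algebraMap ℝ ℂ) (algebraMap ℝ ℂ).injective
  rw [map_rename, map_realFiberPolarization, rename_fiberPolarization]
  intro i
  rw [degreeOf_map_algebraMap]
  exact hp i

omit s in
/-- `Π↑ p` is multi-affine (real case). [cite: BorceaBranden2009, §2.2] -/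
theorem isMultiAffine_realFiberPolarization (p : MvPolynomial τ ℝ) : IsMultiAffine (realFiberPolarization b p) :=
  isMultiAffine_map_algebraMap_iff.1 (by rw [map_realFiberPolarization]; exact isMultiAffine_fiberPolarization b _)

omit s in
/-- **`Π↑ p` is real stable iff `p` is** (Prop. 2.4, real form). [cite: BorceaBranden2009, §2.2 Prop. 2.4] -/
theorem isRealStable_realFiberPolarization_iff [DecidableEq σ] {p : MvPolynomial τ ℝ}
    (hp : ∀ i, degreeOf i p ≤ (fiber b i).card) :
    IsRealStable (realFiberPolarization b p) ↔ IsRealStable p := by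
  rw [IsRealStable, IsRealStable, map_realFiberPolarization]
  exact isUpperHalfPlaneStable_fiberPolarization_iff b fun i => by rw [degreeOf_map_algebraMap]; exact hp i

omit [Fintype τ] in
/-- **`T` preserves real stability on `ℝ_κ[z_τ]` ⇒ `L` preserves real stability on multi-affine polynomials.**
[cite: BorceaBranden2009, §2.2 ("(a) The linear operators `Π↑_κ` and `Π↓_κ` preserve stability")] -/
theorem realFiberLift_preserves (hs : ∀ i, b (s i) = i) (T : MvPolynomial τ ℝ →ₗ[ℝ] MvPolynomial τ ℝ)
    (hT : ∀ p : MvPolynomial τ ℝ, (∀ i, degreeOf i p ≤ (fiber b i).card) → IsRealStable p →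
      IsRealStable (T p) ∨ T p = 0)
    {f : MvPolynomial σ ℝ} (hf : IsMultiAffine f) (hst : IsRealStable f) :
    IsRealStable (realFiberLift b s T f) ∨ realFiberLift b s T f = 0 := by
  rw [realFiberLift_apply]
  rcases hT _ (degreeOf_rename_le_card_fiber_real b hf) (hst.rename_fiberMap b) with h | h
  · exact Or.inl ((isRealStable_rename_section_iff b s hs _).2 h)
  · exact Or.inr (by rw [h, map_zero])

/-- **`L` preserves real stability on multi-affine polynomials ⇒ `T` preserves real stability on `ℝ_κ[z_τ]`.**
[cite: BorceaBranden2009, §2.2 Prop. 2.4 and "(b) `Π↓_κ ∘ Π↑_κ = id`"] -/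
theorem preserves_of_realFiberLift [DecidableEq σ] (hs : ∀ i, b (s i) = i)
    (T : MvPolynomial τ ℝ →ₗ[ℝ] MvPolynomial τ ℝ)
    (hL : ∀ f : MvPolynomial σ ℝ, IsMultiAffine f → IsRealStable f →
      IsRealStable (realFiberLift b s T f) ∨ realFiberLift b s T f = 0)
    {p : MvPolynomial τ ℝ} (hp : ∀ i, degreeOf i p ≤ (fiber b i).card) (hst : IsRealStable p) :
    IsRealStable (T p) ∨ T p = 0 := by
  have h := hL (realFiberPolarization b p) (isMultiAffine_realFiberPolarization b p)
    ((isRealStable_realFiberPolarization_iff b hp).2 hst)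
  rw [realFiberLift_apply, rename_realFiberPolarization b hp] at h
  rcases h with h | h
  · exact Or.inl ((isRealStable_rename_section_iff b s hs _).1 h)
  · exact Or.inr (rename_section_injective_real b s hs (by rw [h, map_zero]))

end RealLift

/-! ## §2 Complexification and the two symbol conditions -/

section Symbols

variable [Fintype σ] [DecidableEq σ] [Fintype τ] [DecidableEq τ]

omit [Fintype σ] [DecidableEq σ] [Fintype τ] [DecidableEq τ] in
/-- `ι ∘ T_ℂ ∘ Π↓` agrees with `(L)_ℂ` on complexified real polynomials. [cite: BorceaBranden2009, §4 proof of
Thm. 1.2 (complex case applied to a real operator)] -/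
theorem fiberLift_complexify_map (T : MvPolynomial τ ℝ →ₗ[ℝ] MvPolynomial τ ℝ) (f : MvPolynomial σ ℝ) :
    fiberLift b s (complexify T) (map (algebraMap ℝ ℂ) f) = map (algebraMap ℝ ℂ) (realFiberLift b s T f) := by
  rw [fiberLift_apply, realFiberLift_apply, ← map_rename, complexify_map, map_rename]

omit [Fintype σ] [DecidableEq σ] [Fintype τ] [DecidableEq τ] in
/-- **`(L)_ℂ = ι ∘ T_ℂ ∘ Π↓`.** [cite: BorceaBranden2009, §4 proof of Thm. 1.2] -/
theorem complexify_realFiberLift (T : MvPolynomial τ ℝ →ₗ[ℝ] MvPolynomial τ ℝ) :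
    complexify (realFiberLift b s T) = fiberLift b s (complexify T) := by
  refine (basisMonomials σ ℂ).ext fun m => ?_
  have hm : (basisMonomials σ ℂ m : MvPolynomial σ ℂ) = map (algebraMap ℝ ℂ) (monomial m 1) := by
    rw [coe_basisMonomials, map_monomial, map_one]
  rw [hm, complexify_map, fiberLift_complexify_map]

/-- **(b) for `L` is (b) for `T`**: the real symbol of `L` is real stable iff
`T_ℂ[Π_i (z_i + w_i)^{κ_i}](z) ≠ 0` for `z, w ∈ ℋ^τ`. [cite: BorceaBranden2009, §4 proof of Thm. 1.2 ("we may
therefore assume that `G_T(z,w)` is real stable. But then the desired conclusion simply follows from the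
complex case") and §2.2] -/
theorem isRealStable_realMultiAffineSymbol_realFiberLift_iff (hs : ∀ i, b (s i) = i)
    (T : MvPolynomial τ ℝ →ₗ[ℝ] MvPolynomial τ ℝ) :
    IsRealStable (realMultiAffineSymbol (realFiberLift b s T)) ↔
      ∀ z w : τ → ℂ, (∀ i, 0 < (z i).im) → (∀ i, 0 < (w i).im) →
        eval z (complexify T (∏ i, (X i + C (w i)) ^ (fiber b i).card)) ≠ 0 := by
  rw [IsRealStable, ← multiAffineSymbol_complexify, complexify_realFiberLift,
    isUpperHalfPlaneStable_multiAffineSymbol_fiberLift_iff b s hs]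

omit [Fintype σ] [DecidableEq σ] [Fintype τ] [DecidableEq τ] in
/-- **The flipped operator `T'(f) = (-1)^N T(f(-z))`** (`N = |σ| = |κ|`). [cite: BorceaBranden2009, §4 proof of
Thm. 1.2 ("`T'(f)(z) = (-1)^κ T(f(-z))`")] -/
def signedFlip (N : ℕ) (T : MvPolynomial τ ℝ →ₗ[ℝ] MvPolynomial τ ℝ) : MvPolynomial τ ℝ →ₗ[ℝ] MvPolynomial τ ℝ :=
  ((-1 : ℝ) ^ N) • (T ∘ₗ (negVars : MvPolynomial τ ℝ →ₐ[ℝ] MvPolynomial τ ℝ).toLinearMap)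

omit [Fintype σ] [DecidableEq σ] [Fintype τ] [DecidableEq τ] in
/-- `T'(f) = (-1)^N T(f(-z))`. [cite: BorceaBranden2009, §4 proof of Thm. 1.2] -/
theorem signedFlip_apply (N : ℕ) (T : MvPolynomial τ ℝ →ₗ[ℝ] MvPolynomial τ ℝ) (f : MvPolynomial τ ℝ) :
    signedFlip N T f = ((-1 : ℝ) ^ N) • T (negVars f) :=
  rfl

omit [Fintype σ] [DecidableEq σ] [Fintype τ] [DecidableEq τ] in
/-- `Π↓(f(-z)) = (Π↓ f)(-z)`. [cite: BorceaBranden2009, §4 (`f(-z)`)] -/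
theorem rename_negVars {R : Type*} [CommRing R] (f : MvPolynomial σ R) :
    rename b (negVars f) = negVars (rename b f) := by
  have h : (fun i => rename b (-X i : MvPolynomial σ R)) = (fun i => -X i) ∘ b :=
    funext fun v => by rw [Function.comp_apply, map_neg, rename_X]
  rw [negVars, negVars, rename_bind₁, bind₁_rename, h]

omit [DecidableEq σ] [Fintype τ] [DecidableEq τ] in
/-- **`(L)' = (T')~`**: the twist of the lift is the lift of the flip. [cite: BorceaBranden2009, §4 proof of Thm. 1.2
("these operators are related by `T'(f)(z) = (-1)^κ T(f(-z))`")] -/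
theorem negTwist_realFiberLift (T : MvPolynomial τ ℝ →ₗ[ℝ] MvPolynomial τ ℝ) :
    negTwist (realFiberLift b s T) = realFiberLift b s (signedFlip (Fintype.card σ) T) := by
  refine LinearMap.ext fun f => ?_
  rw [negTwist_apply, realFiberLift_apply, realFiberLift_apply, signedFlip_apply, rename_negVars, map_smul]

/-- **(c) for `L` is (b) for `T'`.** [cite: BorceaBranden2009, §4 proof of Thm. 1.2 ("hence they preserve real
stability simultaneously")] -/
theorem isRealStable_negInr_realMultiAffineSymbol_realFiberLift_iff (hs : ∀ i, b (s i) = i)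
    (T : MvPolynomial τ ℝ →ₗ[ℝ] MvPolynomial τ ℝ) :
    IsRealStable (negInr (realMultiAffineSymbol (realFiberLift b s T))) ↔
      ∀ z w : τ → ℂ, (∀ i, 0 < (z i).im) → (∀ i, 0 < (w i).im) →
        eval z (complexify (signedFlip (Fintype.card σ) T) (∏ i, (X i + C (w i)) ^ (fiber b i).card)) ≠ 0 := by
  rw [← realMultiAffineSymbol_negTwist, negTwist_realFiberLift,
    isRealStable_realMultiAffineSymbol_realFiberLift_iff b s hs]

omit [Fintype σ] [DecidableEq σ] [Fintype τ] [DecidableEq τ] in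
/-- `(T')_ℂ = (-1)^N (T_ℂ)(f(-z))`. [cite: BorceaBranden2009, §4 proof of Thm. 1.2] -/
theorem complexify_signedFlip_apply (N : ℕ) (T : MvPolynomial τ ℝ →ₗ[ℝ] MvPolynomial τ ℝ) (g : MvPolynomial τ ℂ) :
    complexify (signedFlip N T) g = ((-1 : ℂ) ^ N) • complexify T (negVars g) := by
  have h : complexify (signedFlip N T) =
      ((-1 : ℂ) ^ N) • (complexify T ∘ₗ (negVars : MvPolynomial τ ℂ →ₐ[ℂ] MvPolynomial τ ℂ).toLinearMap) := by
    refine (basisMonomials τ ℂ).ext fun m => ?_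
    have hm : (basisMonomials τ ℂ m : MvPolynomial τ ℂ) = map (algebraMap ℝ ℂ) (monomial m 1) := by
      rw [coe_basisMonomials, map_monomial, map_one]
    rw [hm, complexify_map, signedFlip_apply, LinearMap.smul_apply, LinearMap.comp_apply, AlgHom.toLinearMap_apply,
      ← map_negVars, complexify_map, smul_eq_C_mul, smul_eq_C_mul,
      _root_.map_mul (MvPolynomial.map (algebraMap ℝ ℂ)), map_C]
    congr 2
    rw [map_pow, map_neg, map_one]
  rw [h]
  rfl

omit [DecidableEq σ] in
/-- **`G_{T'}(z,w) = G_T(z,-w)` on block powers**: `T'_ℂ[Π_i (z_i + w_i)^{κ_i}] = T_ℂ[Π_i (z_i - w_i)^{κ_i}]` when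
`N = Σ_i κ_i = |σ|`. [cite: BorceaBranden2009, §4 proof of Thm. 1.2 ("whose symbols satisfy
`G_{T'}(z,w) = G_T(z,-w)`")] -/
theorem complexify_signedFlip_prod (T : MvPolynomial τ ℝ →ₗ[ℝ] MvPolynomial τ ℝ) (w : τ → ℂ) :
    complexify (signedFlip (Fintype.card σ) T) (∏ i, (X i + C (w i)) ^ (fiber b i).card) =
      complexify T (∏ i, (X i + C (-w i)) ^ (fiber b i).card) := by
  have hN : Fintype.card σ = ∑ i, (fiber b i).card := by
    rw [← card_univ, card_eq_sum_card_fiberwise (t := univ) fun v _ => mem_univ (b v)]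
    rfl
  have hneg : negVars (∏ i, (X i + C (w i)) ^ (fiber b i).card : MvPolynomial τ ℂ) =
      ((-1 : ℂ) ^ Fintype.card σ) • ∏ i, (X i + C (-w i)) ^ (fiber b i).card := by
    rw [map_prod, hN, ← prod_pow_eq_pow_sum, smul_eq_C_mul, map_prod, ← prod_mul_distrib]
    refine prod_congr rfl fun i _ => ?_
    rw [map_pow, map_add, negVars_C, C_pow, ← mul_pow, negVars, bind₁_X_right]
    simp only [map_neg, map_one]
    ring
  rw [complexify_signedFlip_apply, hneg, map_smul, smul_smul, ← mul_pow, neg_mul_neg, one_mul, one_pow, one_smul]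

end Symbols

/-! ## §3 The rank-two alternative and Theorem 1.2 along a fiber map -/

section RankTwo

omit b s

/-- Coordinates along one nonzero vector. [folklore] -/
private theorem exists_coord_singleton' {M : Type*} [AddCommGroup M] [Module ℝ M] {P : M} (hP : P ≠ 0) :
    ∃ α : M →ₗ[ℝ] ℝ, ∀ a : ℝ, α (a • P) = a := by
  obtain ⟨L, hL⟩ := LinearMap.exists_leftInverse_of_injective
    (LinearMap.toSpanSingleton ℝ M P) (LinearMap.ker_toSpanSingleton ℝ hP)
  exact ⟨L, fun a => by simpa using LinearMap.congr_fun hL a⟩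

/-- Coordinates along two independent vectors. [folklore] -/
private theorem exists_coord_pair' {M : Type*} [AddCommGroup M] [Module ℝ M] {P Q : M}
    (hPQ : ∀ c d : ℝ, c • P + d • Q = 0 → c = 0 ∧ d = 0) :
    ∃ α β : M →ₗ[ℝ] ℝ, ∀ a d : ℝ, α (a • P + d • Q) = a ∧ β (a • P + d • Q) = d := by
  set ψ : ℝ × ℝ →ₗ[ℝ] M := (LinearMap.toSpanSingleton ℝ M P).coprod (LinearMap.toSpanSingleton ℝ M Q)
    with hψ_def
  have hψ : ∀ ab : ℝ × ℝ, ψ ab = ab.1 • P + ab.2 • Q := fun ab => by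
    simp [hψ_def]
  have hker : LinearMap.ker ψ = ⊥ := LinearMap.ker_eq_bot'.2 fun ab hab => by
    rw [hψ] at hab
    obtain ⟨h1, h2⟩ := hPQ _ _ hab
    exact Prod.ext h1 h2
  obtain ⟨L, hL⟩ := LinearMap.exists_leftInverse_of_injective ψ hker
  refine ⟨(LinearMap.fst ℝ ℝ ℝ).comp L, (LinearMap.snd ℝ ℝ ℝ).comp L, fun a d => ?_⟩
  have had := LinearMap.congr_fun hL (a, d)
  rw [LinearMap.comp_apply, hψ, LinearMap.id_apply] at had
  simp [had]

variable [Fintype τ]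

/-- **All `T(p)`, `p ∈ D`, real stable or zero ⇒ (a) on `D`**, for any real subspace `D ⊆ ℝ[z_τ]`: the image
`T(D)` has dimension at most two (Lemma 3.2 (i)), any two of its elements are comparable for `≪` (Thm. 1.9), and
`T(p) = α(p)P + β(p)Q` with `P ≪ Q` real stable. [cite: BorceaBranden2009, §4 proof of Thm. 1.2 ("all nonzero
polynomials in the image of `T` are real stable and by Lemma 3.2 … the image of `T` is of dimension at most
two") and §3 Lemma 3.2 (i)] -/
theorem exists_rankTwo_of_forall_mem (D : Submodule ℝ (MvPolynomial τ ℝ))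
    (T : MvPolynomial τ ℝ →ₗ[ℝ] MvPolynomial τ ℝ) (himg : ∀ p ∈ D, T p = 0 ∨ IsRealStable (T p)) :
    ∃ (α β : MvPolynomial τ ℝ →ₗ[ℝ] ℝ) (P Q : MvPolynomial τ ℝ), IsRealStable P ∧ IsRealStable Q ∧
      IsProperPosition P Q ∧ ∀ p ∈ D, T p = α p • P + β p • Q := by
  classical
  set V : Submodule ℝ (MvPolynomial τ ℝ) := D.map T with hV_def
  have hmemV : ∀ p ∈ D, T p ∈ V := fun p hp => Submodule.mem_map_of_mem hp
  have hV : ∀ q ∈ V, q = 0 ∨ IsRealStable q := by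
    intro q hq
    obtain ⟨p, hp, rfl⟩ := Submodule.mem_map.1 hq
    exact himg p hp
  by_cases hzero : ∀ p ∈ D, T p = 0
  · refine ⟨0, 0, 1, 1, isRealStable_one, isRealStable_one, isRealStable_one.isProperPosition_self,
      fun p hp => ?_⟩
    rw [hzero p hp, LinearMap.zero_apply, zero_smul, add_zero]
  push Not at hzero
  obtain ⟨p₀, hp₀, hP0⟩ := hzero
  set P := T p₀ with hP_def
  have hPs : IsRealStable P := (himg p₀ hp₀).resolve_left hP0
  by_cases hline : ∀ p ∈ D, ∃ a : ℝ, T p = a • P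
  · obtain ⟨α, hα⟩ := exists_coord_singleton' hP0
    refine ⟨α.comp T, 0, P, P, hPs, hPs, hPs.isProperPosition_self, fun p hp => ?_⟩
    obtain ⟨a, ha⟩ := hline p hp
    rw [LinearMap.comp_apply, ha, hα, LinearMap.zero_apply, zero_smul, add_zero]
  push Not at hline
  obtain ⟨p₁, hp₁, hQ⟩ := hline
  set Q := T p₁ with hQ_def
  have hQ0 : Q ≠ 0 := fun h => hQ 0 (by rw [h, zero_smul])
  have hQs : IsRealStable Q := (himg p₁ hp₁).resolve_left hQ0
  have hind : ∀ c d : ℝ, c • P + d • Q = 0 → c = 0 ∧ d = 0 := by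
    intro c d hcd
    by_cases hd : d = 0
    · rw [hd, zero_smul, add_zero] at hcd
      exact ⟨(smul_eq_zero.1 hcd).resolve_right hP0, hd⟩
    · exfalso
      refine hQ (-(d⁻¹ * c)) ?_
      have hQ' : Q = d⁻¹ • (d • Q) := by rw [smul_smul, inv_mul_cancel₀ hd, one_smul]
      rw [hQ', eq_neg_of_add_eq_zero_right hcd, smul_neg, smul_smul, neg_smul]
  have hspan : ∀ p ∈ D, ∃ a d : ℝ, T p = a • P + d • Q := by
    intro p hp
    by_contra hnot
    push Not at hnot
    have hmem : ∀ i, ![T p, P, Q] i ∈ V := by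
      intro i
      fin_cases i
      · exact hmemV _ hp
      · exact hmemV _ hp₀
      · exact hmemV _ hp₁
    refine not_linearIndependent_of_forall_mem hV hmem (Fintype.linearIndependent_iff.2 fun g hg => ?_)
    have hg' : g 0 • T p + g 1 • P + g 2 • Q = 0 := by simpa [Fin.sum_univ_three] using hg
    have hg0 : g 0 = 0 := by
      by_contra hg0
      refine hnot (-((g 0)⁻¹ * g 1)) (-((g 0)⁻¹ * g 2)) ?_
      have hTf : T p = (g 0)⁻¹ • (g 0 • T p) := by rw [smul_smul, inv_mul_cancel₀ hg0, one_smul]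
      have hsum : g 0 • T p = -(g 1 • P + g 2 • Q) :=
        eq_neg_of_add_eq_zero_left (by rw [← add_assoc]; exact hg')
      rw [hTf, hsum, smul_neg, smul_add, smul_smul, smul_smul, neg_add, neg_smul, neg_smul]
    rw [hg0, zero_smul, zero_add] at hg'
    obtain ⟨h1, h2⟩ := hind _ _ hg'
    intro i
    fin_cases i
    · exact hg0
    · exact h1
    · exact h2
  rcases isProperPosition_or_of_forall_mem hV (hmemV _ hp₀) (hmemV _ hp₁) with ⟨hP0', -⟩ | hPQ | hQP
  · exact absurd hP0' hP0
  · obtain ⟨α, β, hαβ⟩ := exists_coord_pair' hind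
    refine ⟨α.comp T, β.comp T, P, Q, hPs, hQs, hPQ, fun p hp => ?_⟩
    obtain ⟨a, d, had⟩ := hspan p hp
    rw [LinearMap.comp_apply, LinearMap.comp_apply, had, (hαβ a d).1, (hαβ a d).2]
  · have hind' : ∀ c d : ℝ, c • Q + d • P = 0 → c = 0 ∧ d = 0 := fun c d hcd =>
      (hind d c (by rwa [add_comm] at hcd)).symm
    obtain ⟨α, β, hαβ⟩ := exists_coord_pair' hind'
    refine ⟨α.comp T, β.comp T, Q, P, hQs, hPs, hQP, fun p hp => ?_⟩
    obtain ⟨a, d, had⟩ := hspan p hp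
    rw [LinearMap.comp_apply, LinearMap.comp_apply, had, add_comm (a • P), (hαβ d a).1, (hαβ d a).2]

/-- **The space `ℝ_κ[z_τ]`** of real polynomials of degree `≤ κ_i` in `z_i`, as a submodule.
[cite: BorceaBranden2009, §1.1 (the space `𝕂_κ[z_1,…,z_n]`)] -/
def degreeLESubmodule (κ : τ → ℕ) : Submodule ℝ (MvPolynomial τ ℝ) where
  carrier := {p | ∀ i, degreeOf i p ≤ κ i}
  add_mem' {p q} hp hq i := (degreeOf_add_le i p q).trans (max_le (hp i) (hq i))
  zero_mem' i := by
    rw [degreeOf_zero]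
    exact Nat.zero_le _
  smul_mem' c p hp i := by
    rw [smul_eq_C_mul]
    exact (degreeOf_C_mul_le p i c).trans (hp i)

omit [Fintype τ] in
/-- Membership in `ℝ_κ[z_τ]`. [cite: BorceaBranden2009, §1.1] -/
theorem mem_degreeLESubmodule {κ : τ → ℕ} {p : MvPolynomial τ ℝ} :
    p ∈ degreeLESubmodule κ ↔ ∀ i, degreeOf i p ≤ κ i :=
  Iff.rfl

end RankTwo

section MainFiber

variable [Fintype σ] [DecidableEq σ] [Fintype τ] [DecidableEq τ]

/-- **Borcea–Brändén I, Theorem 1.2 along a fiber map** (`κ_i = |b⁻¹(i)| ≥ 1`, `s` a section of `b`).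
[cite: BorceaBranden2009, §1.1 Thm. 1.2 and §§2.2, 4 (its proof via the multi-affine case)] -/
theorem boundedDegree_realStabilityPreserver_iff_fiber (hs : ∀ i, b (s i) = i)
    (T : MvPolynomial τ ℝ →ₗ[ℝ] MvPolynomial τ ℝ) :
    (∀ p : MvPolynomial τ ℝ, (∀ i, degreeOf i p ≤ (fiber b i).card) → IsRealStable p →
        IsRealStable (T p) ∨ T p = 0) ↔
      ((∃ (α β : MvPolynomial τ ℝ →ₗ[ℝ] ℝ) (P Q : MvPolynomial τ ℝ), IsRealStable P ∧ IsRealStable Q ∧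
          IsProperPosition P Q ∧
            ∀ p : MvPolynomial τ ℝ, (∀ i, degreeOf i p ≤ (fiber b i).card) → T p = α p • P + β p • Q) ∨
        (∀ z w : τ → ℂ, (∀ i, 0 < (z i).im) → (∀ i, 0 < (w i).im) →
          eval z (complexify T (∏ i, (X i + C (w i)) ^ (fiber b i).card)) ≠ 0) ∨
        (∀ z w : τ → ℂ, (∀ i, 0 < (z i).im) → (∀ i, 0 < (w i).im) →
          eval z (complexify T (∏ i, (X i + C (-w i)) ^ (fiber b i).card)) ≠ 0)) := by
  have hc : (∀ z w : τ → ℂ, (∀ i, 0 < (z i).im) → (∀ i, 0 < (w i).im) →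
        eval z (complexify T (∏ i, (X i + C (-w i)) ^ (fiber b i).card)) ≠ 0) ↔
      IsRealStable (negInr (realMultiAffineSymbol (realFiberLift b s T))) := by
    rw [isRealStable_negInr_realMultiAffineSymbol_realFiberLift_iff b s hs]
    simp only [complexify_signedFlip_prod]
  rw [hc, ← isRealStable_realMultiAffineSymbol_realFiberLift_iff b s hs]
  constructor
  · intro hT
    rcases forall_apply_or_symbol (realFiberLift b s T) (fun f hf hst => realFiberLift_preserves b s hs T hT hf hst)
      with himg | hb | hc'
    · refine Or.inl ?_
      obtain ⟨α, β, P, Q, hP, hQ, hPQ, hT'⟩ := exists_rankTwo_of_forall_mem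
        (degreeLESubmodule fun i => (fiber b i).card) T fun p hp => by
          have h := himg (realFiberPolarization b p) (isMultiAffine_realFiberPolarization b p)
          rw [realFiberLift_apply, rename_realFiberPolarization b (mem_degreeLESubmodule.1 hp)] at h
          rcases h with h | h
          · exact Or.inl (rename_section_injective_real b s hs (by rw [h, map_zero]))
          · exact Or.inr ((isRealStable_rename_section_iff b s hs _).1 h)
      exact ⟨α, β, P, Q, hP, hQ, hPQ, fun p hp => hT' p (mem_degreeLESubmodule.2 hp)⟩
    · exact Or.inr (Or.inl hb)
    · exact Or.inr (Or.inr hc')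
  · rintro (⟨α, β, P, Q, -, -, hPQ, hαβ⟩ | hb | hc') p hp hst
    · rw [hαβ p hp, smul_eq_C_mul, smul_eq_C_mul]
      exact (hPQ.pencil (α p) (β p)).symm
    · exact preserves_of_realFiberLift b s hs T (fun f hf hst' => realStabilityPreserver_of_symbol hb hf hst') hp hst
    · exact preserves_of_realFiberLift b s hs T
        (fun f hf hst' => realStabilityPreserver_of_symbol_neg hc' hf hst') hp hst

end MainFiber

/-! ## §4 Theorem 1.2 for `κ : τ → ℕ`, `κ_i ≥ 1` -/

section Kappa

variable [Fintype τ] [DecidableEq τ]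

/-- **The real symbol `G_T(z,w) = T[(z+w)^κ] ∈ ℝ[z_τ, w_τ]`.** [cite: BorceaBranden2009, §1.1 (G_T), Thm. 1.2 (b)] -/
def realBoundedDegreeSymbol (κ : τ → ℕ) (T : MvPolynomial τ ℝ →ₗ[ℝ] MvPolynomial τ ℝ) : MvPolynomial (τ ⊕ τ) ℝ :=
  ∑ α ∈ Fintype.piFinset fun i => range (κ i + 1),
    (∏ i, (((κ i).choose (α i) : ℕ) : ℝ)) •
      (rename Sum.inl (T (∏ i, X i ^ α i)) * ∏ i, X (Sum.inr i) ^ (κ i - α i))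

/-- **The real symbol `G_T(z,-w) = Σ_{α ≤ κ} binom(κ,α) T(z^α)(z) (-w)^{κ-α} ∈ ℝ[z_τ, w_τ]`.**
[cite: BorceaBranden2009, §1.1 Thm. 1.2 (c)] -/
def realBoundedDegreeSymbolNeg (κ : τ → ℕ) (T : MvPolynomial τ ℝ →ₗ[ℝ] MvPolynomial τ ℝ) :
    MvPolynomial (τ ⊕ τ) ℝ :=
  ∑ α ∈ Fintype.piFinset fun i => range (κ i + 1),
    (∏ i, (((κ i).choose (α i) : ℕ) : ℝ)) •
      (rename Sum.inl (T (∏ i, X i ^ α i)) * ∏ i, (-X (Sum.inr i)) ^ (κ i - α i))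

/-- `G_T` complexifies to `G_{T_ℂ}`. [cite: BorceaBranden2009, §1.1 (G_T) and §4 proof of Thm. 1.2] -/
theorem map_realBoundedDegreeSymbol (κ : τ → ℕ) (T : MvPolynomial τ ℝ →ₗ[ℝ] MvPolynomial τ ℝ) :
    map (algebraMap ℝ ℂ) (realBoundedDegreeSymbol κ T) = boundedDegreeSymbol κ (complexify T) := by
  rw [realBoundedDegreeSymbol, boundedDegreeSymbol, map_sum]
  refine sum_congr rfl fun α _ => ?_
  have hmono : (∏ i, X i ^ α i : MvPolynomial τ ℂ) = map (algebraMap ℝ ℂ) (∏ i, X i ^ α i) := by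
    rw [_root_.map_prod (MvPolynomial.map (algebraMap ℝ ℂ))]
    simp only [map_pow, map_X]
  rw [smul_eq_C_mul, smul_eq_C_mul, _root_.map_mul (MvPolynomial.map (algebraMap ℝ ℂ)), map_C,
    _root_.map_mul (MvPolynomial.map (algebraMap ℝ ℂ)), map_rename, hmono, complexify_map,
    _root_.map_prod (MvPolynomial.map (algebraMap ℝ ℂ)), map_prod (algebraMap ℝ ℂ)]
  simp only [map_pow, map_X, map_natCast]

/-- **Evaluating `G_T(z,-w)`**: the complexification of `realBoundedDegreeSymbolNeg` at `(z,w)` is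
`T_ℂ[Π_i (z_i - w_i)^{κ_i}](z)`. [cite: BorceaBranden2009, §1.1 Thm. 1.2 (c)] -/
theorem eval_map_realBoundedDegreeSymbolNeg (κ : τ → ℕ) (T : MvPolynomial τ ℝ →ₗ[ℝ] MvPolynomial τ ℝ)
    (z w : τ → ℂ) :
    eval (Sum.elim z w) (map (algebraMap ℝ ℂ) (realBoundedDegreeSymbolNeg κ T)) =
      eval z (complexify T (∏ i, (X i + C (-w i)) ^ κ i)) := by
  rw [← eval_boundedDegreeSymbol, ← map_realBoundedDegreeSymbol, realBoundedDegreeSymbolNeg,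
    realBoundedDegreeSymbol, map_sum, map_sum, map_sum, map_sum]
  refine sum_congr rfl fun α _ => ?_
  rw [smul_eq_C_mul, smul_eq_C_mul]
  simp only [_root_.map_mul, map_C, map_prod, map_pow, map_neg, map_X, eval_X, eval_C, Sum.elim_inr,
    map_rename, eval_rename, Sum.elim_comp_inl]

/-- **Borcea–Brändén I, Theorem 1.2 (every number of variables, every `κ` with `κ_i ≥ 1`).** A linear operator
`T` on `ℝ[z_τ]` maps every real stable polynomial of `ℝ_κ[z_τ]` (degree `≤ κ_i` in `z_i`) to a real stable
polynomial or to `0` if and only if either (a) `T(p) = α(p)P + β(p)Q` on `ℝ_κ[z_τ]` with real linear functionals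
`α, β` and real stable `P ≪ Q`, or (b) `G_T(z,w) = T[(z+w)^κ] ∈ 𝓗_{2n}(ℝ)`, or (c) `G_T(z,-w) ∈ 𝓗_{2n}(ℝ)`.
[cite: BorceaBranden2009, §1.1 Thm. 1.2] -/
theorem BorceaBranden_realStabilityPreserver_iff {κ : τ → ℕ} (hκ : ∀ i, 0 < κ i)
    (T : MvPolynomial τ ℝ →ₗ[ℝ] MvPolynomial τ ℝ) :
    (∀ p : MvPolynomial τ ℝ, (∀ i, degreeOf i p ≤ κ i) → IsRealStable p → IsRealStable (T p) ∨ T p = 0) ↔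
      ((∃ (α β : MvPolynomial τ ℝ →ₗ[ℝ] ℝ) (P Q : MvPolynomial τ ℝ), IsRealStable P ∧ IsRealStable Q ∧
          IsProperPosition P Q ∧ ∀ p : MvPolynomial τ ℝ, (∀ i, degreeOf i p ≤ κ i) → T p = α p • P + β p • Q) ∨
        IsRealStable (realBoundedDegreeSymbol κ T) ∨ IsRealStable (realBoundedDegreeSymbolNeg κ T)) := by
  have h := boundedDegree_realStabilityPreserver_iff_fiber (Sigma.fst : (Σ j, Fin (κ j)) → τ)
    (fun i => ⟨i, ⟨0, hκ i⟩⟩) (fun _ => rfl) T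
  simp only [card_fiber_sigma_fst] at h
  rw [h, IsRealStable, map_realBoundedDegreeSymbol, isUpperHalfPlaneStable_boundedDegreeSymbol_iff, IsRealStable]
  have hneg : IsUpperHalfPlaneStable (map (algebraMap ℝ ℂ) (realBoundedDegreeSymbolNeg κ T)) ↔
      ∀ z w : τ → ℂ, (∀ i, 0 < (z i).im) → (∀ i, 0 < (w i).im) →
        eval z (complexify T (∏ i, (X i + C (-w i)) ^ κ i)) ≠ 0 := by
    constructor
    · intro h' z w hz hw
      have h'' := h' (Sum.elim z w) (by rintro (i | i) <;> simp [hz, hw])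
      rwa [eval_map_realBoundedDegreeSymbolNeg] at h''
    · intro h' zw hzw
      rw [← Sum.elim_comp_inl_inr zw, eval_map_realBoundedDegreeSymbolNeg]
      exact h' _ _ (fun i => hzw (Sum.inl i)) fun i => hzw (Sum.inr i)
  rw [hneg]

end Kappa

end Literature.Combinatorics.StablePolynomials

end
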